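import Literature.Computability.Complexity.UniformDerandomizationDistinguisher
import HarnessLib

/-!
# Uniform PRG ⟹ i.o. pseudo-time simulation of `BPP` (Trevisan–Vadhan 2007, Lemma 2.3):
# the reduction of `impagliazzoWigderson1998(_samplable)` to the uniform-generator hinge

Literature / complexity — third file of the discharge-in-progress of the named facts
`impagliazzoWigderson1998_samplable` (`UniformDerandomization.lean`, van Melkebeek 2000, Thm. 6.2.1 =
Impagliazzo–Wigderson 1998, Thm. 5) and `impagliazzoWigderson1998` (`UniformDerandomizationRandAlg.lean`,
the printed sampler class; the two are equivalent, `UniformDerandomizationEquiv.lean`).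

The printed proof (Impagliazzo–Wigderson 1998; Trevisan–Vadhan 2007, §3, Thm. 3.9 and Lemma 2.3)
has two halves: (i) `BPP ≠ EXP` yields, for every polynomial stretch, a generator computable in time
`2^{ℓ^{c₀}}` that no uniform probabilistic polynomial-time test distinguishes at every large index
(Trevisan–Vadhan Thm. 3.9 = IW98: Nisan–Wigderson generator + uniform reconstruction + downward
self-reducibility + `EXP ⊆ P/poly ⟹ EXP = Σ₂ ⊆ P^{#P}`); (ii) such a generator derandomizes `BPP`
infinitely often on every samplable distribution (Trevisan–Vadhan Lemma 2.3; Kabanets's observation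
that one algorithm serves all samplers and all rates `m^{-d}`). This file PROVES HALF (ii) in the
tree's vocabulary and thereby REDUCES both named facts to half (i), stated as an explicit hypothesis
(the "hinge", written inline: `∃ c₀, ∀ k, ∃ G`, `G` computable in time `2^{ℓ^{c₀}}` on the pad and
fooling every uniform probabilistic polynomial-time test i.o. at every rate `1/ℓ^c`; a hypothesis of
theorems, not a named fact, D-0026):

* `UDerand.printed_of_uniformPRG` — hinge ⟹ the conclusion of `impagliazzoWigderson1998` for `A ∈ BPP`,
  `ε > 0`: the language is `UDerand.simLang` (`UniformDerandomizationMachine.lean`, in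
  `DTIME(2^{⌈n^ε⌉₊})` at `c₀ 2^{-J} < ε`), and a sampler `M` defeating it at rate `m^{-d}` for all large
  `m` gives the distinguisher `UDerand.distinguisher` (`UniformDerandomizationDistinguisher.lean`) with
  advantage `≥ 1/ℓ^{2^J d + 1}` for all large `ℓ` — the index `ℓ ↦ n = ℓ^{2^J}` being a right inverse
  of the simulation's `n ↦ ⌊√⌋^{J}(n)` — against the pseudorandomness hypothesis;
* **`impagliazzoWigderson1998_of_uniformPRG`**, **`impagliazzoWigderson1998_samplable_of_uniformPRG`**.

## The estimate (Trevisan–Vadhan 2007, proof of Lemma 2.3)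

With `V(x, r) = [⟨x, r⟩ ∈ L₁]` of error `η = 2^{-n}` (`BPP_subset_bpErr_two_pow`), `p_x = Pr_s[V(x,s)]`,
`g_x = Pr_σ[V(x, G ℓ σ ↾ q₁(n))]`: on uniform `r`, `Pr[T = 1] = E_x[2 p_x (1 - p_x)] ≤ 2η`
(`UDerand.unifAvg_le`); on pseudorandom `r`, `Pr[T = 1] = E_x[g_x (1-p_x) + (1-g_x) p_x] ≥ (1-η) δ / 2`
where `δ = Pr_x[A(x) ≠ B(x)] ≥ n^{-d}` (`UDerand.le_seedAvg`), since `B(x) = [g_x > 1/2]`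
(`UDerand.mem_simLang_iff`); so the advantage is `≥ n^{-d}/2 - 3η ≥ n^{-d}/4 = ℓ^{-2^J d}/4`.

## References

* L. Trevisan, S. Vadhan, *Pseudorandomness and average-case complexity via uniform reductions*,
  Comput. Complexity 16 (2007) 331–364, Lemma 2.3 (statement and proof), §2.1 (Kabanets's remark),
  Thm. 3.9 [TrevisanVadhan2007].
* R. Impagliazzo, A. Wigderson, *Randomness vs time: derandomization under a uniform assumption*,
  JCSS 63 (2001) 672–688 (FOCS 1998), Thm. 5 [ImpagliazzoWigderson2001].
* D. van Melkebeek, *Randomness and Completeness in Computational Complexity*, LNCS 1950 (2000),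
  Thm. 6.2.1 [VanMelkebeek2000].
* V. Kabanets, *Easiness assumptions and hardness tests: trading time for zero error*, JCSS 63
  (2001) 236–252 (the `PseudoTIME` reading).
-/

noncomputable section

namespace Literature.Computability.Complexity

open _root_.Computability Finset Filter Polynomial Brick Plumb MetaComplexity

namespace UDerand

open scoped Classical

/-- `|1^m| = m` for Mathlib's unary numerals (private copy, as in `UniformDerandomizationEquiv.lean`).
[folklore] -/
private theorem length_unaryEncodeNat' (m : ℕ) : (unaryEncodeNat m).length = m := by
  rw [OracleCompose.unaryEncodeNat_eq_replicate, List.length_replicate]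

/-! ### The pointwise estimates of Trevisan–Vadhan's Lemma 2.3 -/

/-- On a truly random string the test fires with probability `2 p (1 - p) ≤ 2η` when `p ≤ η` or
`1 - p ≤ η`. [cite: TrevisanVadhan2007, Lemma 2.3 (proof: "`T` outputs `1` with probability at most `2 · 2^{-Ω(n)}`")] -/
theorem two_mul_mul_le {p η : ℝ} (hp0 : 0 ≤ p) (hp1 : p ≤ 1) (h : p ≤ η ∨ 1 - p ≤ η) :
    2 * p * (1 - p) ≤ 2 * η := by
  rcases h with h | h <;> nlinarith

/-- The pseudorandom firing probability is nonnegative. [folklore] -/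
theorem term_nonneg {p g : ℝ} (hp0 : 0 ≤ p) (hp1 : p ≤ 1) (hg0 : 0 ≤ g) (hg1 : g ≤ 1) :
    0 ≤ g * (1 - p) + (1 - g) * p := by nlinarith

/-- On an input where the majority vote errs, the test fires with probability `≥ (1 - η)/2`.
[cite: TrevisanVadhan2007, Lemma 2.3 (proof: "`T` outputs `1` with probability at least `(1/2)·(1/n^c)`")] -/
theorem term_ge_of_fail {p g η : ℝ} (hp0 : 0 ≤ p) (hp1 : p ≤ 1) (hg0 : 0 ≤ g) (hg1 : g ≤ 1) (hη1 : η ≤ 1)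
    {inA : Prop} (hη : (inA → 1 - p ≤ η) ∧ (¬ inA → p ≤ η)) (hfail : ¬ (inA ↔ 1 / 2 < g)) :
    (1 - η) / 2 ≤ g * (1 - p) + (1 - g) * p := by
  by_cases ha : inA
  · have hg : g ≤ 1 / 2 := not_lt.1 fun h => hfail ⟨fun _ => h, fun _ => ha⟩
    have hp : 1 - η ≤ p := by linarith [hη.1 ha]
    have h1 : (1 - g) * (1 - η) ≤ (1 - g) * p := mul_le_mul_of_nonneg_left hp (by linarith)
    have h2 : 1 / 2 * (1 - η) ≤ (1 - g) * (1 - η) := mul_le_mul_of_nonneg_right (by linarith) (by linarith)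
    have h3 : 0 ≤ g * (1 - p) := mul_nonneg hg0 (by linarith)
    linarith
  · have hg : 1 / 2 < g := by
      by_contra h
      exact hfail ⟨fun h' => absurd h' ha, fun h' => absurd h' h⟩
    have hp : 1 - η ≤ 1 - p := by linarith [hη.2 ha]
    have h1 : g * (1 - η) ≤ g * (1 - p) := mul_le_mul_of_nonneg_left hp hg0
    have h2 : 1 / 2 * (1 - η) ≤ g * (1 - η) := mul_le_mul_of_nonneg_right hg.le (by linarith)
    have h3 : 0 ≤ (1 - g) * p := mul_nonneg (by linarith) hp0
    linarith

/-- Averages swap: `avg_r avg_u f = avg_u avg_r f`. [folklore] -/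
theorem avg_swap {α β : Type*} [Fintype α] [Fintype β] (f : α → β → ℝ) (X Y : ℝ) :
    (∑ r : β, (∑ u : α, f u r) / X) / Y = (∑ u : α, (∑ r : β, f u r) / Y) / X := by
  rw [← sum_div, ← sum_div, sum_comm, div_div, div_div, mul_comm]

/-! ### The analysis at one index `ℓ` -/

section Analysis

variable (L₁ : Language Bool) (q₁ : Polynomial ℕ) (S : RandAlg ℕ (List Bool)) (qS : Polynomial ℕ)
  (K k c₀ : ℕ) (G : ℕ → List Bool → List Bool) (ℓ : ℕ)

/-- `p_x = Pr_{s ∈ {0,1}^{q₁(n)}}[⟨x, s⟩ ∈ L₁]`, `n = ℓ^K`. [cite: TrevisanVadhan2007, Lemma 2.3 (proof)] -/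
def pOf (x : List Bool) : ℝ := uniformProb (q₁.eval (ℓ ^ K)) {v | boolPair x v ∈ L₁}

/-- `g_x = Pr_{σ ∈ {0,1}^{ℓ^{c₀}}}[⟨x, G ℓ σ ↾ q₁(n)⟩ ∈ L₁]` (the fraction of seeds making the `BPP`
predicate accept). [cite: TrevisanVadhan2007, Lemma 2.3 (proof)] -/
def gOf (x : List Bool) : ℝ :=
  uniformProb (ℓ ^ c₀) {σ | boolPair x (List.takeD (q₁.eval (ℓ ^ K)) (G ℓ σ) false) ∈ L₁}

/-- The sample `x_u = S(1ⁿ; u)`. [folklore] -/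
def xOf (u : List.Vector Bool (qS.eval (ℓ ^ K))) : List Bool := S.run (ℓ ^ K) u.toList

/-- `V(x, s) = 1 ↔ ⟨x, s⟩ ∈ L₁`. [folklore] -/
theorem V_eq_true_iff (x s : List Bool) : V L₁ x s = true ↔ boolPair x s ∈ L₁ :=
  (Set.mem_iff_boolIndicator _ _).symm

/-- `Pr_s[V(x, y) ≠ V(x, s)]` is `1 - p_x` or `p_x` according as `V(x, y)` is `1` or `0`.
[cite: TrevisanVadhan2007, Lemma 2.3 (proof)] -/
theorem uniformProb_ne_eq (x y : List Bool) :
    uniformProb (q₁.eval (ℓ ^ K)) {s | V L₁ x y ≠ V L₁ x s} =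
      if V L₁ x y = true then 1 - pOf L₁ q₁ K ℓ x else pOf L₁ q₁ K ℓ x := by
  unfold pOf
  cases h : V L₁ x y
  · simp only [Bool.false_eq_true, if_false]
    congr 1
    ext s
    simp only [Set.mem_setOf_eq, ne_eq, ← V_eq_true_iff]
    cases V L₁ x s <;> simp
  · simp only [if_true]
    rw [← uniformProb_compl]
    congr 1
    ext s
    simp only [Set.mem_setOf_eq, ne_eq, Set.mem_compl_iff, ← V_eq_true_iff]
    cases V L₁ x s <;> simp

/-- **The uniform average** (hypothesis `q₁(n) ≤ ℓ^k`, so that `r ↾ q₁(n)` is uniform):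
`unifAvg = E_u[2 p_{x_u} (1 - p_{x_u})]`. [cite: TrevisanVadhan2007, Lemma 2.3 (proof)] -/
theorem unifAvg_eq (hb : q₁.eval (ℓ ^ K) ≤ ℓ ^ k) :
    unifAvg k (distinguisher L₁ q₁ S qS K) ℓ =
      (∑ u : List.Vector Bool (qS.eval (ℓ ^ K)),
        2 * pOf L₁ q₁ K ℓ (xOf S qS K ℓ u) * (1 - pOf L₁ q₁ K ℓ (xOf S qS K ℓ u))) / 2 ^ qS.eval (ℓ ^ K) := by
  classical
  unfold unifAvg
  simp only [pr_distinguisher]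
  rw [avg_swap]
  refine congrArg (· / _) (sum_congr rfl fun u _ => ?_)
  simp only [uniformProb_ne_eq, xOf]
  rw [avg_ite_eq]
  -- the fraction of `r` with `V(x_u, r ↾ b) = 1` is `p_{x_u}`
  have hq : ((univ.filter fun r : List.Vector Bool (ℓ ^ k) =>
      V L₁ (S.run (ℓ ^ K) u.toList) (List.takeD (q₁.eval (ℓ ^ K)) r.toList false) = true).card : ℝ) /
      2 ^ ℓ ^ k = pOf L₁ q₁ K ℓ (S.run (ℓ ^ K) u.toList) := by
    rw [pOf, ← uniformProb_takeD_prefix hb, uniformProb_eq_card_filter]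
    congr 2
    exact congrArg Finset.card (filter_congr fun r _ => by rw [V_eq_true_iff]; exact Iff.rfl)
  rw [hq]
  ring

/-- **The pseudorandom average** (hypothesis `q₁(n) ≤ ℓ^k`):
`seedAvg = E_u[g_{x_u} (1 - p_{x_u}) + (1 - g_{x_u}) p_{x_u}]`. [cite: TrevisanVadhan2007, Lemma 2.3 (proof)] -/
theorem seedAvg_eq (hb : q₁.eval (ℓ ^ K) ≤ ℓ ^ k) :
    seedAvg c₀ k G (distinguisher L₁ q₁ S qS K) ℓ =
      (∑ u : List.Vector Bool (qS.eval (ℓ ^ K)),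
        (gOf L₁ q₁ K c₀ G ℓ (xOf S qS K ℓ u) * (1 - pOf L₁ q₁ K ℓ (xOf S qS K ℓ u)) +
          (1 - gOf L₁ q₁ K c₀ G ℓ (xOf S qS K ℓ u)) * pOf L₁ q₁ K ℓ (xOf S qS K ℓ u))) / 2 ^ qS.eval (ℓ ^ K) := by
  classical
  unfold seedAvg
  simp only [pr_distinguisher, takeD_takeD_of_le hb]
  rw [avg_swap]
  refine congrArg (· / _) (sum_congr rfl fun u _ => ?_)
  simp only [uniformProb_ne_eq, xOf]
  rw [avg_ite_eq]
  have hq : ((univ.filter fun σ : List.Vector Bool (ℓ ^ c₀) =>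
      V L₁ (S.run (ℓ ^ K) u.toList) (List.takeD (q₁.eval (ℓ ^ K)) (G ℓ σ.toList) false) = true).card : ℝ) /
      2 ^ ℓ ^ c₀ = gOf L₁ q₁ K c₀ G ℓ (S.run (ℓ ^ K) u.toList) := by
    rw [gOf, uniformProb_eq_card_filter]
    congr 2
    exact congrArg Finset.card (filter_congr fun σ _ => by rw [V_eq_true_iff]; exact Iff.rfl)
  rw [hq]

/-- `0 ≤ p_x ≤ 1`. [folklore] -/
theorem pOf_mem (x : List Bool) : 0 ≤ pOf L₁ q₁ K ℓ x ∧ pOf L₁ q₁ K ℓ x ≤ 1 :=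
  ⟨uniformProb_nonneg _ _, uniformProb_le_one _ _⟩

/-- `0 ≤ g_x ≤ 1`. [folklore] -/
theorem gOf_mem (x : List Bool) : 0 ≤ gOf L₁ q₁ K c₀ G ℓ x ∧ gOf L₁ q₁ K c₀ G ℓ x ≤ 1 :=
  ⟨uniformProb_nonneg _ _, uniformProb_le_one _ _⟩

variable {L₁ q₁ S qS K k c₀ G ℓ}

/-- **The uniform average is small**: if every sample `x_u` has `p ≤ η` (off `A`) or `1 - p ≤ η` (on `A`),
then `unifAvg ≤ 2η`. [cite: TrevisanVadhan2007, Lemma 2.3 (proof)] -/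
theorem unifAvg_le (hb : q₁.eval (ℓ ^ K) ≤ ℓ ^ k) {A : Language Bool} {η : ℝ}
    (hη : ∀ u : List.Vector Bool (qS.eval (ℓ ^ K)),
      (xOf S qS K ℓ u ∈ A → 1 - pOf L₁ q₁ K ℓ (xOf S qS K ℓ u) ≤ η) ∧
      (xOf S qS K ℓ u ∉ A → pOf L₁ q₁ K ℓ (xOf S qS K ℓ u) ≤ η)) :
    unifAvg k (distinguisher L₁ q₁ S qS K) ℓ ≤ 2 * η := by
  rw [unifAvg_eq L₁ q₁ S qS K k ℓ hb]
  have h2 : (0 : ℝ) < 2 ^ qS.eval (ℓ ^ K) := by positivity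
  rw [div_le_iff₀ h2]
  have hcard : (Fintype.card (List.Vector Bool (qS.eval (ℓ ^ K))) : ℝ) = 2 ^ qS.eval (ℓ ^ K) := by
    rw [card_vector, Fintype.card_bool]; push_cast; rfl
  calc ∑ u : List.Vector Bool (qS.eval (ℓ ^ K)), 2 * pOf L₁ q₁ K ℓ (xOf S qS K ℓ u) * (1 - pOf L₁ q₁ K ℓ (xOf S qS K ℓ u))
      ≤ ∑ _u : List.Vector Bool (qS.eval (ℓ ^ K)), 2 * η := by
        refine sum_le_sum fun u _ => ?_
        obtain ⟨hp0, hp1⟩ := pOf_mem L₁ q₁ K ℓ (xOf S qS K ℓ u)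
        refine two_mul_mul_le hp0 hp1 ?_
        by_cases hx : xOf S qS K ℓ u ∈ A
        · exact Or.inr ((hη u).1 hx)
        · exact Or.inl ((hη u).2 hx)
    _ = 2 * η * 2 ^ qS.eval (ℓ ^ K) := by rw [sum_const, card_univ, nsmul_eq_mul, hcard]; ring

/-- **The pseudorandom average is large**: under the same hypothesis, `seedAvg ≥ (1 - η)/2 · δ'` where
`δ'` is the fraction of coin strings `u` whose sample fails, `¬ (x_u ∈ A ↔ g_{x_u} > 1/2)`.
[cite: TrevisanVadhan2007, Lemma 2.3 (proof)] -/
theorem le_seedAvg (hb : q₁.eval (ℓ ^ K) ≤ ℓ ^ k) {A : Language Bool} {η : ℝ} (hη1 : η ≤ 1)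
    (hη : ∀ u : List.Vector Bool (qS.eval (ℓ ^ K)),
      (xOf S qS K ℓ u ∈ A → 1 - pOf L₁ q₁ K ℓ (xOf S qS K ℓ u) ≤ η) ∧
      (xOf S qS K ℓ u ∉ A → pOf L₁ q₁ K ℓ (xOf S qS K ℓ u) ≤ η)) :
    (1 - η) / 2 * (((univ.filter fun u : List.Vector Bool (qS.eval (ℓ ^ K)) =>
        ¬ (xOf S qS K ℓ u ∈ A ↔ 1 / 2 < gOf L₁ q₁ K c₀ G ℓ (xOf S qS K ℓ u))).card : ℝ) / 2 ^ qS.eval (ℓ ^ K)) ≤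
      seedAvg c₀ k G (distinguisher L₁ q₁ S qS K) ℓ := by
  classical
  rw [seedAvg_eq L₁ q₁ S qS K k c₀ G ℓ hb]
  have h2 : (0 : ℝ) < 2 ^ qS.eval (ℓ ^ K) := by positivity
  rw [← mul_div_assoc, div_le_div_iff_of_pos_right h2]
  set fail := univ.filter fun u : List.Vector Bool (qS.eval (ℓ ^ K)) =>
      ¬ (xOf S qS K ℓ u ∈ A ↔ 1 / 2 < gOf L₁ q₁ K c₀ G ℓ (xOf S qS K ℓ u)) with hfail
  set term : List.Vector Bool (qS.eval (ℓ ^ K)) → ℝ := fun u =>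
      gOf L₁ q₁ K c₀ G ℓ (xOf S qS K ℓ u) * (1 - pOf L₁ q₁ K ℓ (xOf S qS K ℓ u)) +
        (1 - gOf L₁ q₁ K c₀ G ℓ (xOf S qS K ℓ u)) * pOf L₁ q₁ K ℓ (xOf S qS K ℓ u) with hterm
  calc (1 - η) / 2 * (fail.card : ℝ) = ∑ _u ∈ fail, (1 - η) / 2 := by
        rw [sum_const, nsmul_eq_mul, mul_comm]
    _ ≤ ∑ u ∈ fail, term u := by
        refine sum_le_sum fun u hu => ?_
        rw [hfail, mem_filter] at hu
        obtain ⟨hp0, hp1⟩ := pOf_mem L₁ q₁ K ℓ (xOf S qS K ℓ u)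
        obtain ⟨hg0, hg1⟩ := gOf_mem L₁ q₁ K c₀ G ℓ (xOf S qS K ℓ u)
        exact term_ge_of_fail hp0 hp1 hg0 hg1 hη1 (hη u) hu.2
    _ ≤ ∑ u, term u :=
        sum_le_sum_of_subset_of_nonneg (filter_subset _ _) fun u _ _ => by
          obtain ⟨hp0, hp1⟩ := pOf_mem L₁ q₁ K ℓ (xOf S qS K ℓ u)
          obtain ⟨hg0, hg1⟩ := gOf_mem L₁ q₁ K c₀ G ℓ (xOf S qS K ℓ u)
          exact term_nonneg hp0 hp1 hg0 hg1

end Analysis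

/-! ### The simulated language is the majority vote `[g_x > 1/2]` -/

section MemSim

variable (L₁ : Language Bool) (q₁ : Polynomial ℕ) (c₀ J : ℕ) {F : List Bool → List Bool}
  {G : ℕ → List Bool → List Bool}

/-- **`B(x) = [g_x > 1/2]`**: for `|x| = ℓ^{2^J}` (so that the simulation's index is `⌊√⌋^{J}(|x|) = ℓ`,
`ellOf_pow`) and a string function `F` computing `G` on the pad, `x ∈ simLang ↔ 1/2 < g_x`
(the `2^{ℓ^{c₀}}` seeds `bits_s i` enumerate `{0,1}^{ℓ^{c₀}}`, `CoinEnum.sum_range_ite_natBits`).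
[cite: TrevisanVadhan2007, Lemma 2.3 (proof: "`A(x) = maj_s M(x; G(s))`")] -/
theorem mem_simLang_iff
    (hFG : ∀ (ℓ : ℕ) (σ : List Bool), σ.length = ℓ ^ c₀ →
      F (ones (2 ^ ℓ ^ c₀) ++ false :: boolPair (ones ℓ) σ) = G ℓ σ)
    (ℓ : ℕ) (x : List Bool) (hx : x.length = ℓ ^ 2 ^ J) :
    x ∈ simLang L₁ q₁ F c₀ J ↔ 1 / 2 < gOf L₁ q₁ (2 ^ J) c₀ G ℓ x := by
  classical
  have hell : ellOf J x.length = ℓ := by rw [hx, ellOf_pow]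
  have hs : sOf c₀ J x.length = ℓ ^ c₀ := by rw [sOf, hell]
  rw [gOf, half_lt_uniformProb_iff]
  show 2 ^ sOf c₀ J x.length < 2 * accCount L₁ q₁ F c₀ J x ↔ _
  rw [hs]
  suffices h : accCount L₁ q₁ F c₀ J x =
      cnt (ℓ ^ c₀) {σ | boolPair x (List.takeD (q₁.eval (ℓ ^ 2 ^ J)) (G ℓ σ) false) ∈ L₁} by rw [h]
  rw [accCount, hs, hell, hx, ← CoinEnum.sum_range_ite_natBits]
  refine sum_congr rfl fun i hi => ?_
  rw [hFG ℓ _ (List.takeD_length _ _ _), PRGDerand.takeD_encodeNat_eq_natBits (mem_range.1 hi)]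
  by_cases h : natBits (ℓ ^ c₀) i ∈ {σ | boolPair x (List.takeD (q₁.eval (ℓ ^ 2 ^ J)) (G ℓ σ) false) ∈ L₁}
  · rw [if_pos h, (Set.mem_iff_boolIndicator _ _).1 (show _ ∈ L₁ from h)]; rfl
  · rw [if_neg h, (Set.notMem_iff_boolIndicator _ _).1 (show _ ∉ L₁ from h)]; rfl

end MemSim

/-! ### The advantage at one index -/

section Advantage

variable {L₁ : Language Bool} {q₁ : Polynomial ℕ} {S : RandAlg ℕ (List Bool)} {qS : Polynomial ℕ}
  {K k c₀ J d : ℕ} {F : List Bool → List Bool} {G : ℕ → List Bool → List Bool} {A : Language Bool}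

/-- **The advantage of the distinguisher at a good index** (Trevisan–Vadhan 2007, proof of Lemma 2.3,
quantified): at `ℓ ≥ 4` with `n = ℓ^K`, `K = 2^J`, `q₁(n) ≤ ℓ^k`, `10 n^d ≤ 2^n`, if the `BPP` predicate
has error `≤ 2^{-n}` on length-`n` inputs, the sampler (exact budget `qS`, length-preserving) defeats
the simulation at rate `n^{-d}`, and `F` computes `G` on the pad, then
`seedAvg - unifAvg ≥ 1/ℓ^{K d + 1}`. [cite: TrevisanVadhan2007, Lemma 2.3 (proof)] -/
theorem adv_ge (hK : K = 2 ^ J) (ℓ : ℕ) (h4 : 4 ≤ ℓ)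
    (hqS : ∀ m, S.coinLen m = qS.eval m)
    (hlen : ∀ m r, r.length = S.coinLen m → (S.run m r).length = m)
    (hη : ∀ x : List Bool, uniformProb (q₁.eval x.length) {y | ¬ (boolPair x y ∈ L₁ ↔ x ∈ A)} ≤ 1 / 2 ^ x.length)
    (hFG : ∀ (ℓ : ℕ) (σ : List Bool), σ.length = ℓ ^ c₀ →
      F (ones (2 ^ ℓ ^ c₀) ++ false :: boolPair (ones ℓ) σ) = G ℓ σ)
    (hb : q₁.eval (ℓ ^ K) ≤ ℓ ^ k)
    (h10 : (10 : ℝ) * ((ℓ ^ K : ℕ) : ℝ) ^ d ≤ 2 ^ (ℓ ^ K))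
    (hfailm : ¬ (1 - 1 / ((ℓ ^ K : ℕ) : ℝ) ^ d <
      S.pr unaryEncodeNat (ℓ ^ K) {x | x ∈ A ↔ x ∈ simLang L₁ q₁ F c₀ J})) :
    1 / (ℓ : ℝ) ^ (K * d + 1) ≤
      seedAvg c₀ k G (distinguisher L₁ q₁ S qS K) ℓ - unifAvg k (distinguisher L₁ q₁ S qS K) ℓ := by
  set η : ℝ := 1 / 2 ^ (ℓ ^ K) with hηdef
  set Fset : Set (List Bool) := {x | ¬ (x ∈ A ↔ x ∈ simLang L₁ q₁ F c₀ J)} with hFset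
  have hℓpos : 0 < ℓ := by omega
  have hnpos : 0 < ℓ ^ K := Nat.pow_pos hℓpos
  have hnR : (1 : ℝ) ≤ ((ℓ ^ K : ℕ) : ℝ) := by exact_mod_cast hnpos
  -- lengths of the samples
  have hxlen : ∀ u : List.Vector Bool (qS.eval (ℓ ^ K)), (xOf S qS K ℓ u).length = ℓ ^ K := fun u =>
    hlen _ _ (by rw [List.Vector.toList_length, hqS])
  -- the error hypothesis at the samples
  have hηu : ∀ u : List.Vector Bool (qS.eval (ℓ ^ K)),
      (xOf S qS K ℓ u ∈ A → 1 - pOf L₁ q₁ K ℓ (xOf S qS K ℓ u) ≤ η) ∧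
      (xOf S qS K ℓ u ∉ A → pOf L₁ q₁ K ℓ (xOf S qS K ℓ u) ≤ η) := by
    intro u
    have h := hη (xOf S qS K ℓ u)
    rw [hxlen u] at h
    constructor
    · intro hxA
      have hset : {y : List Bool | ¬ (boolPair (xOf S qS K ℓ u) y ∈ L₁ ↔ xOf S qS K ℓ u ∈ A)} =
          {y | boolPair (xOf S qS K ℓ u) y ∈ L₁}ᶜ := by
        ext y; simp [hxA]
      rw [hset, uniformProb_compl] at h
      exact h
    · intro hxA
      have hset : {y : List Bool | ¬ (boolPair (xOf S qS K ℓ u) y ∈ L₁ ↔ xOf S qS K ℓ u ∈ A)} =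
          {y | boolPair (xOf S qS K ℓ u) y ∈ L₁} := by
        ext y; simp [hxA]
      rw [hset] at h
      exact h
  -- the failure probability `δ ≥ n^{-d}` as a fraction of coin strings
  have hδ : 1 / ((ℓ ^ K : ℕ) : ℝ) ^ d ≤ ((univ.filter fun u : List.Vector Bool (qS.eval (ℓ ^ K)) =>
      ¬ (xOf S qS K ℓ u ∈ A ↔ 1 / 2 < gOf L₁ q₁ K c₀ G ℓ (xOf S qS K ℓ u))).card : ℝ) / 2 ^ qS.eval (ℓ ^ K) := by
    have h1 : S.pr unaryEncodeNat (ℓ ^ K) {x | x ∈ A ↔ x ∈ simLang L₁ q₁ F c₀ J} =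
        1 - uniformProb (qS.eval (ℓ ^ K)) {u | S.run (ℓ ^ K) u ∈ Fset} := by
      rw [RandAlg.pr_eq_uniformProb, length_unaryEncodeNat', hqS, ← uniformProb_compl]
      congr 1
      ext u
      simp [hFset]
    have h2 : 1 / ((ℓ ^ K : ℕ) : ℝ) ^ d ≤ uniformProb (qS.eval (ℓ ^ K)) {u | S.run (ℓ ^ K) u ∈ Fset} := by
      rw [not_lt, h1] at hfailm
      linarith
    refine h2.trans (le_of_eq ?_)
    rw [uniformProb_eq_card_filter]
    congr 2
    exact congrArg Finset.card (filter_congr fun (u : List.Vector Bool (qS.eval (ℓ ^ K))) _ => by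
      have hm := mem_simLang_iff L₁ q₁ c₀ J hFG ℓ (xOf S qS K ℓ u) (by rw [← hK]; exact hxlen u)
      rw [← hK] at hm
      show ¬ (xOf S qS K ℓ u ∈ A ↔ xOf S qS K ℓ u ∈ simLang L₁ q₁ F c₀ J) ↔ _
      rw [hm])
  -- the two averages
  have hη1 : η ≤ 1 := by
    rw [hηdef, div_le_one (by positivity)]; exact one_le_pow₀ (by norm_num)
  have hη0 : 0 ≤ η := by positivity
  have hU := unifAvg_le hb hηu
  have hG := le_seedAvg (c₀ := c₀) (G := G) hb hη1 hηu
  have hδ'1 : ((univ.filter fun u : List.Vector Bool (qS.eval (ℓ ^ K)) =>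
      ¬ (xOf S qS K ℓ u ∈ A ↔ 1 / 2 < gOf L₁ q₁ K c₀ G ℓ (xOf S qS K ℓ u))).card : ℝ) / 2 ^ qS.eval (ℓ ^ K) ≤ 1 := by
    rw [div_le_one (by positivity)]
    have := card_filter_le (univ : Finset (List.Vector Bool (qS.eval (ℓ ^ K))))
      (fun u => ¬ (xOf S qS K ℓ u ∈ A ↔ 1 / 2 < gOf L₁ q₁ K c₀ G ℓ (xOf S qS K ℓ u)))
    rw [card_univ, card_vector, Fintype.card_bool] at this
    exact_mod_cast this
  -- arithmetic
  have hnd : (0 : ℝ) < ((ℓ ^ K : ℕ) : ℝ) ^ d := by positivity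
  have hηn : η * (10 * ((ℓ ^ K : ℕ) : ℝ) ^ d) ≤ 1 := by
    rw [hηdef, one_div, inv_mul_le_iff₀ (by positivity)]
    linarith
  have hℓ : (4 : ℝ) * ((ℓ ^ K : ℕ) : ℝ) ^ d ≤ (ℓ : ℝ) ^ (K * d + 1) := by
    rw [pow_succ, pow_mul]
    push_cast
    have h4R : (4 : ℝ) ≤ ℓ := by exact_mod_cast h4
    have h0 : (0 : ℝ) ≤ ((ℓ : ℝ) ^ K) ^ d := by positivity
    nlinarith
  calc 1 / (ℓ : ℝ) ^ (K * d + 1) ≤ 1 / (4 * ((ℓ ^ K : ℕ) : ℝ) ^ d) := one_div_le_one_div_of_le (by positivity) hℓ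
    _ ≤ (1 - η) / 2 * (((univ.filter fun u : List.Vector Bool (qS.eval (ℓ ^ K)) =>
          ¬ (xOf S qS K ℓ u ∈ A ↔ 1 / 2 < gOf L₁ q₁ K c₀ G ℓ (xOf S qS K ℓ u))).card : ℝ) / 2 ^ qS.eval (ℓ ^ K)) -
          2 * η := by
        rw [div_le_iff₀ (by positivity)]
        have h1 : 1 / ((ℓ ^ K : ℕ) : ℝ) ^ d * (4 * ((ℓ ^ K : ℕ) : ℝ) ^ d) = 4 := by field_simp
        nlinarith [hδ, hδ'1, hηn, hη0, hη1, mul_nonneg hη0 hnd.le,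
          mul_le_mul_of_nonneg_right hδ (show (0:ℝ) ≤ 4 * ((ℓ ^ K : ℕ) : ℝ) ^ d by positivity)]
    _ ≤ _ := by linarith

end Advantage

/-! ### Eventual bookkeeping -/

/-- `q₁(ℓ^K) ≤ ℓ^{K k_q + 1}` for all large `ℓ` (`q₁(m) ≤ c_q m^{k_q} + c_q`). [folklore] -/
theorem eventually_eval_pow_le (q₁ : Polynomial ℕ) (K : ℕ) :
    ∃ k : ℕ, ∀ᶠ ℓ : ℕ in atTop, q₁.eval (ℓ ^ K) ≤ ℓ ^ k := by
  obtain ⟨cq, kq, hcq⟩ := exists_eval_le_mul_pow_add q₁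
  refine ⟨K * kq + 1, ?_⟩
  filter_upwards [eventually_ge_atTop (2 * cq + 1)] with ℓ hℓ
  have h1 := hcq (ℓ ^ K)
  have h2 : 1 ≤ ℓ ^ (K * kq) := Nat.one_le_pow _ _ (by omega)
  calc q₁.eval (ℓ ^ K) ≤ cq * (ℓ ^ K) ^ kq + cq := h1
    _ = cq * ℓ ^ (K * kq) + cq := by rw [← pow_mul]
    _ ≤ (2 * cq + 1) * ℓ ^ (K * kq) := by nlinarith
    _ ≤ ℓ * ℓ ^ (K * kq) := Nat.mul_le_mul_right _ hℓ
    _ = ℓ ^ (K * kq + 1) := by ring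

/-- `10 n^d ≤ 2^n` for all large `n` (real form; `n^d / 2^n → 0`). [folklore] -/
theorem eventually_ten_mul_pow_le (d : ℕ) : ∀ᶠ n : ℕ in atTop, (10 : ℝ) * (n : ℝ) ^ d ≤ 2 ^ n := by
  have h := tendsto_pow_const_div_const_pow_of_one_lt d (one_lt_two : (1 : ℝ) < 2)
  filter_upwards [h.eventually (eventually_lt_nhds (by norm_num : (0 : ℝ) < 1 / 10))] with n hn
  rw [div_lt_iff₀ (by positivity)] at hn
  linarith

/-! ### The reduction -/

/-- **Half (ii) of the printed proof: a uniform generator derandomizes `BPP` infinitely often on every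
uniformly samplable distribution** (Trevisan–Vadhan 2007, Lemma 2.3, in the `PseudoTIME` form of
van Melkebeek's Thm. 6.2.1 / the conclusion of `impagliazzoWigderson1998`): if for every polynomial
stretch `k` some `G` is computable in time `2^{ℓ^{c₀}}` on the pad and fools uniform probabilistic
polynomial time i.o. at every rate, then for every `A ∈ BPP` and `ε > 0` the language
`simLang` (index depth `J` with `c₀ 2^{-J} < ε`, `exists_root_depth`) is in `DTIME(2^{⌈n^ε⌉₊})` and agrees with `A` with
probability `> 1 - m^{-d}` for infinitely many `m`, for every `d` and every PPT sampler with an exact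
polynomial coin budget. [cite: TrevisanVadhan2007, Lemma 2.3] [cite: VanMelkebeek2000, Thm. 6.2.1] -/
theorem printed_of_uniformPRG {c₀ : ℕ}
    (hGk : ∀ k : ℕ, ∃ G : ℕ → List Bool → List Bool,
      (∃ F ∈ FP, ∀ (ℓ : ℕ) (σ : List Bool), σ.length = ℓ ^ c₀ →
          F (ones (2 ^ ℓ ^ c₀) ++ false :: boolPair (ones ℓ) σ) = G ℓ σ) ∧
      ∀ T : RandAlg (List Bool) Bool, T.IsPolyTime id encodeBool →
        (∃ q : Polynomial ℕ, ∀ N, T.coinLen N = q.eval N) → ∀ c : ℕ,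
          ∃ᶠ ℓ : ℕ in atTop, |seedAvg c₀ k G T ℓ - unifAvg k T ℓ| < 1 / (ℓ : ℝ) ^ c)
    {A : Language Bool} (hA : A ∈ BPP) {ε : ℝ} (hε : 0 < ε) :
    ∃ B ∈ DTIME (fun n => 2 ^ ⌈(n : ℝ) ^ ε⌉₊),
      ∀ (d : ℕ) (M : RandAlg ℕ (List Bool)), M.IsPolyTime unaryEncodeNat (id : List Bool → List Bool) →
        (∃ q : Polynomial ℕ, ∀ m, M.coinLen m = q.eval m) →
        (∀ m r, r.length = M.coinLen m → (M.run m r).length = m) →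
        ∃ᶠ m : ℕ in atTop, 1 - 1 / (m : ℝ) ^ d < M.pr unaryEncodeNat m {x | x ∈ A ↔ x ∈ B} := by
  obtain ⟨L₁, hL₁, q₁, hη⟩ := BPP_subset_bpErr_two_pow 1 hA
  obtain ⟨J, hJ⟩ := exists_root_depth c₀ hε
  obtain ⟨k, hk⟩ := eventually_eval_pow_le q₁ (2 ^ J)
  obtain ⟨G, ⟨F, hF, hFG⟩, hfool⟩ := hGk k
  refine ⟨simLang L₁ q₁ F c₀ J, simLang_mem_DTIME q₁ c₀ J hL₁ hF hJ, fun d M hM hq hlen => ?_⟩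
  obtain ⟨qS, hqS⟩ := hq
  by_contra hnot
  rw [Filter.not_frequently] at hnot
  have hfreq := hfool (distinguisher L₁ q₁ M qS (2 ^ J)) (distinguisher_isPolyTime q₁ qS (2 ^ J) hL₁ hM)
    ⟨_, distinguisher_coinLen_eq L₁ q₁ M qS (2 ^ J)⟩ (2 ^ J * d + 1)
  have hη' : ∀ x : List Bool,
      uniformProb (q₁.eval x.length) {y | ¬ (boolPair x y ∈ L₁ ↔ x ∈ A)} ≤ 1 / 2 ^ x.length := fun x => by
    simpa using hη x
  have htend : Tendsto (fun ℓ : ℕ => ℓ ^ 2 ^ J) atTop atTop := tendsto_pow_atTop (by positivity)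
  have hev : ∀ᶠ ℓ : ℕ in atTop, 1 / (ℓ : ℝ) ^ (2 ^ J * d + 1) ≤
      seedAvg c₀ k G (distinguisher L₁ q₁ M qS (2 ^ J)) ℓ - unifAvg k (distinguisher L₁ q₁ M qS (2 ^ J)) ℓ := by
    filter_upwards [eventually_ge_atTop 4, hk, htend.eventually (eventually_ten_mul_pow_le d),
      htend.eventually hnot] with ℓ h4 hb h10 hfailm
    exact adv_ge rfl ℓ h4 hqS hlen hη' hFG hb h10 hfailm
  obtain ⟨ℓ, hlt, hge⟩ := (hfreq.and_eventually hev).exists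
  have := (le_abs_self _).trans_lt hlt
  linarith

end UDerand

/-! ### The named facts from the hinge -/

/-- **`impagliazzoWigderson1998` (printed sampler class) from the uniform-generator hinge.** What remains
of the printed proof is its half (i): `BPP ≠ EXP ⟹ ∃ c₀, ∀ k, ∃ G` computable in time `2^{ℓ^{c₀}}` on the
pad and fooling uniform probabilistic polynomial time i.o. at every rate `1/ℓ^c` (Trevisan–Vadhan 2007,
Thm. 3.9 = Impagliazzo–Wigderson 1998: two
Nisan–Wigderson generators, uniform reconstruction and downward self-reducibility, Meyer's
`EXP ⊆ P/poly ⟹ EXP = Σ₂`, Toda and Valiant), stated here as the explicit hypothesis `h` (not a named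
fact). [cite: TrevisanVadhan2007, Thm. 3.9 and Lemma 2.3] [cite: ImpagliazzoWigderson2001, Thm. 5]
[cite: VanMelkebeek2000, Thm. 6.2.1] -/
theorem impagliazzoWigderson1998_of_uniformPRG
    (h : BPP ≠ EXP → ∃ c₀ : ℕ, ∀ k : ℕ, ∃ G : ℕ → List Bool → List Bool,
      (∃ F ∈ FP, ∀ (ℓ : ℕ) (σ : List Bool), σ.length = ℓ ^ c₀ →
          F (ones (2 ^ ℓ ^ c₀) ++ false :: boolPair (ones ℓ) σ) = G ℓ σ) ∧
      ∀ T : RandAlg (List Bool) Bool, T.IsPolyTime id encodeBool →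
        (∃ q : Polynomial ℕ, ∀ N, T.coinLen N = q.eval N) → ∀ c : ℕ,
          ∃ᶠ ℓ : ℕ in atTop, |UDerand.seedAvg c₀ k G T ℓ - UDerand.unifAvg k T ℓ| < 1 / (ℓ : ℝ) ^ c) :
    impagliazzoWigderson1998 := by
  intro hne A hA ε hε
  obtain ⟨c₀, hG⟩ := h hne
  exact UDerand.printed_of_uniformPRG hG hA hε

/-- **`impagliazzoWigderson1998_samplable` (the tree's sampler class) from the same hinge**, through the
equivalence of the two renderings (`impagliazzoWigderson1998_samplable_of_printed`).
[cite: VanMelkebeek2000, Thm. 6.2.1] [cite: TrevisanVadhan2007, Thm. 3.9 and Lemma 2.3] -/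
theorem impagliazzoWigderson1998_samplable_of_uniformPRG
    (h : BPP ≠ EXP → ∃ c₀ : ℕ, ∀ k : ℕ, ∃ G : ℕ → List Bool → List Bool,
      (∃ F ∈ FP, ∀ (ℓ : ℕ) (σ : List Bool), σ.length = ℓ ^ c₀ →
          F (ones (2 ^ ℓ ^ c₀) ++ false :: boolPair (ones ℓ) σ) = G ℓ σ) ∧
      ∀ T : RandAlg (List Bool) Bool, T.IsPolyTime id encodeBool →
        (∃ q : Polynomial ℕ, ∀ N, T.coinLen N = q.eval N) → ∀ c : ℕ,
          ∃ᶠ ℓ : ℕ in atTop, |UDerand.seedAvg c₀ k G T ℓ - UDerand.unifAvg k T ℓ| < 1 / (ℓ : ℝ) ^ c) :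
    impagliazzoWigderson1998_samplable :=
  impagliazzoWigderson1998_samplable_of_printed (impagliazzoWigderson1998_of_uniformPRG h)

end Literature.Computability.Complexity

end
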